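import Mathlib.Analysis.SpecialFunctions.Log.Base
import Mathlib.Analysis.SpecialFunctions.Pow.Real
import Mathlib.Analysis.SpecialFunctions.Sqrt
import Mathlib.Analysis.SpecialFunctions.BinaryEntropy
import Mathlib.Analysis.Complex.ExponentialBounds
import HarnessLib

/-!
# Entropy accumulation for the BCMVV18 proof-of-quantumness protocol: the printed closed forms of Merkulov–Arnon-Friedman (Lemma 31, eq. (13)–(14), Lemma 33, Theorem 34)

Topic `Literature/Computability/QuantumComplexity` (cell qa-cr, CENSUS-CR rows CR-P9 / CR-T1; line L-05
`eat-explicit-bcmvv-gap` works on exactly these closed forms; companion of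
`CertifiedRandomnessOracleModelEAT.lean`, which types the analogous constants of the RCS-based protocol).

HONEST FRAMING: this file types ONLY PRINTED CLOSED-FORM REAL FUNCTIONS of
I. Merkulov, R. Arnon-Friedman, *Entropy accumulation under post-quantum cryptographic assumptions*,
Entropy **27** (2025) 772, arXiv:2307.00559 [MerkulovArnonFriedman2023] ("MAF23"), plus elementary
arithmetic about them. The entropy INEQUALITIES themselves (von Neumann / smooth min-entropy of a device's
outputs under the LWE-based NTCF assumption with quantum advice) are NOT typed here — they need the
protocol's cq state as a Lean object and carry a NEGLIGIBLE FUNCTION `ξ(λ)` that the paper leaves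
symbolic ("to find it one requires an explicit bound on `ξ(λ)`", arXiv p.92). No `def … : Prop` fact is
minted; nothing here says any protocol is «secure» or «broken»; nothing bears on BQP vs BPP.

## Source, verbatim — arXiv:2307.00559 (only arXiv version, = the journal text up to numbering;
TeX e-print `rand.tex` / `preliminaries.tex`, line numbers as in the tarball; PDF pages of the arXiv PDF)

* **Theorem 18** (EAT as used; `preliminaries.tex` l.462–480, PDF p.37), eq. (13)–(14):
  `H^ε_min(O⃗ | S⃗ E)_{ρ|Ω} ≥ n t − μ √n`, where
  `μ = 2 (log(1 + 2 d_O) + ⌈‖∇f_min‖_∞⌉) √(1 − 2 log(ε · p_Ω))` (the TeX prints `∇f_max`, sic).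
* **Lemma 31** (`rand.tex` l.323–339, PDF p.54), eq. (17)–(18): for all `c ∈ (1/2, 1]` and some
  negligible `ξ(λ)`,
  `H(Π̃ | E, Y)_Φ ≥ max{0, 1 − √2·A(c)·(1−ω_p)^{1/4} − A(c)·√(1−ω_m)}`
  `× (log₂(1/c) − h(ω_m − 2√(1−ω_p) − √2·A(c)·(1−ω_p)^{1/4} − A(c)·√(1−ω_m)))`
  `− √(1−ω_p)·log₂ 3 − (1 + √(1−ω_p))·h(√(1−ω_p)/(1 + √(1−ω_p))) − ξ(λ)`, with `A(c) := 10/(2c−1)²`.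
  TRANSCRIPTION NOTE (qa-cr F-LIT1-1): the coefficient of the fourth root is `√2 · A(c)` (TeX
  `\sqrt{2}A(c)\sqrt[4]{1-\omega_p}`, forced by the derivation `rand.tex` l.421–433:
  `Tr(Γ_y Ψ_y) ≥ 1 − A(c)(√2 (1−ω_p^y)^{1/4} + √(1−ω_m^y)) − η(λ)`), NOT `√(2A(c))` as a flattened PDF
  text suggests.  The proof works "in the regime where the binary entropy function is strictly
  decreasing … the argument of the binary entropy function, and all of its subsequent lower bounds, are
  larger than 1/2" (l.452–453) — a standing assumption of the printed bound, not encoded in `g` below.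
* eq. (27)–(28) (`rand.tex` l.531–556): `g(ω_p, ω_m) := max_{c ∈ (1/2,1]} g(ω_p, ω_m, c)`,
  `g(ω; β) := min_{ω_p} g(ω_p, ω_m = (ω − (1−β)ω_p)/β)` ("assuming `ω ≥ 1/2`") — NOT typed (sup/inf
  with junk values; lines state what they need about them pointwise).
* **Lemma 33** (`rand.tex` l.600–612), eq. (30): `f_min(p) := (g(ω; β) − ξ(λ)) (1 − βγ)` is a
  min-tradeoff function (`γ = 1 − p(⊥)`, `ω = p(1)/γ`).
* eq. (31)–(33) (`rand.tex` l.642–668): `H^{ε_s}_min(Π̂⃗M̂⃗ | K⃗T⃗G⃗)_{ρ|Ω} ≥ n f_min − μ √n`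
  `=: n (μ_opt(n, ω, γ, ε_s, p_Ω; β) − ξ(λ))`; `f̃_min(ω; ω₀)` = `f_min` below `ω₀`, tangent line above.
* **Theorem 34** (`rand.tex` l.679–690, PDF p.91):
  `H^{ε_s}_min(Π̂⃗ | K⃗T⃗G⃗ E)_{ρ|Ω} ≥ n (μ_opt(n, ω, γ, ε_s/4, p_Ω; β) − ξ(λ) − γ)`
  `− 2 log 7 · √(1 − 2 log(ε_s/4 · p_Ω)) − 3 log(1 − √(1 − (ε_s/4)²))`.
  Every term is explicit EXCEPT `ξ(λ)` (negligible, symbolic) and `μ_opt` (an optimisation, plotted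
  numerically, Fig. 5; rates shown for `n ≈ 10²⁶–10²⁹`, `ω₀ ≥ 1 − 5·10⁻¹²`).

Conventions: `log` of the source is read as `log₂` (bits), as eq. (17) makes explicit for its own terms;
Mathlib's `Real.binEntropy` is in nats, hence `h2 := binEntropy / log 2`.  Lean junk values: `A (1/2) = 0`
(division by zero) — every statement below assumes `1/2 < c`.

## What is here (definitions + elementary lemmas; 0 named facts, 0 sorries)

§1 `mu` (eq. (14)), `eatBound` (eq. (13) right-hand side `n t − μ √n`), `N0 := (μ/t)²` and
`eatBound_nonpos_of_le_N0` (the bound is `≤ 0` for `n ≤ N₀`; arithmetic).  §2 `h2`, `A`, `prefactor`,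
`gLemma31` (eq. (17) without `−ξ(λ)`), with `ten_le_A` (`c ∈ (1/2,1] ⇒ A(c) ≥ 10`),
`prefactor_eq_zero` (the printed prefactor VANISHES whenever `1 − ω_p ≥ 1/40000 = (10√2)⁻⁴`, for every
`c ∈ (1/2,1]` and every `ω_m`) and `gLemma31_eq_of_deadZone` / `gLemma31_nonpos_of_deadZone`
(there the printed single-round bound equals `−√(1−ω_p) log₂3 − (1+√(1−ω_p)) h(·) ≤ 0`) — arithmetic
consequences of eq. (17)–(18) recorded for line L-05.  §3 `fmin` (eq. (30)), `thm34Bound` (Theorem 34's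
right-hand side as a function of `μ_opt` and the other parameters).
The bodies of `mu`, `eatBound`, `N0`, `h2`, `A` are identical to pub/qa-cr line L-05's `line.lean`.
-/

namespace Literature.Computability.QuantumComplexity.ProofOfQuantumnessEATRate

open Real

/-! ## §1 Theorem 18 (EAT as used), eq. (13)–(14) -/

/-- MAF23 eq. (14): the second-order coefficient `μ = 2 (log₂(1 + 2 d_O) + ⌈‖∇f‖_∞⌉) · √(1 − 2 log₂(ε · p_Ω))`
(`d_O` = output dimension, `= 6` for Protocol 1 by Lemma 32; `grad = ‖∇f_min‖_∞`).
[cite: MerkulovArnonFriedman2023, Thm 18 eq. (14)] -/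
noncomputable def mu (dO grad εs pΩ : ℝ) : ℝ :=
  2 * (Real.logb 2 (1 + 2 * dO) + (⌈grad⌉ : ℝ)) * Real.sqrt (1 - 2 * Real.logb 2 (εs * pΩ))

/-- MAF23 eq. (13), right-hand side: `n · t − μ √n`, with `t` the value of the min-tradeoff function on the
accepted frequencies. [cite: MerkulovArnonFriedman2023, Thm 18 eq. (13)] -/
noncomputable def eatBound (n : ℕ) (t dO grad εs pΩ : ℝ) : ℝ :=
  n * t - mu dO grad εs pΩ * Real.sqrt n

/-- The finite-size threshold `N₀ := (μ/t)²` of eq. (13): below it `n t − μ√n ≤ 0` (arithmetic reading of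
[cite: MerkulovArnonFriedman2023, Thm 18 eq. (13)]). -/
noncomputable def N0 (t dO grad εs pΩ : ℝ) : ℝ := (mu dO grad εs pΩ / t) ^ 2

/-- For `0 < t`, `0 ≤ μ` and `n ≤ N₀ = (μ/t)²` the printed bound `n t − μ √n` is `≤ 0`
(arithmetic on [cite: MerkulovArnonFriedman2023, Thm 18 eq. (13)]). -/
theorem eatBound_nonpos_of_le_N0 (n : ℕ) {t dO grad εs pΩ : ℝ} (ht : 0 < t)
    (hμ : 0 ≤ mu dO grad εs pΩ) (hn : (n : ℝ) ≤ N0 t dO grad εs pΩ) :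
    eatBound n t dO grad εs pΩ ≤ 0 := by
  unfold eatBound
  unfold N0 at hn
  set μ := mu dO grad εs pΩ with hμdef
  have hn0 : (0 : ℝ) ≤ n := Nat.cast_nonneg n
  -- `√n ≤ μ / t`, hence `n · t = √n · √n · t ≤ √n · μ`
  have h1 : Real.sqrt n ≤ μ / t := by
    rw [← Real.sqrt_sq (div_nonneg hμ ht.le)]
    exact Real.sqrt_le_sqrt hn
  have h2 : (n : ℝ) * t ≤ μ * Real.sqrt n := by
    calc (n : ℝ) * t = Real.sqrt n * Real.sqrt n * t := by rw [Real.mul_self_sqrt hn0]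
      _ ≤ Real.sqrt n * (μ / t) * t :=
          mul_le_mul_of_nonneg_right (mul_le_mul_of_nonneg_left h1 (Real.sqrt_nonneg _)) ht.le
      _ = μ * Real.sqrt n := by field_simp
  linarith

/-! ## §2 Lemma 31, eq. (17)–(18) -/

/-- Binary entropy in BITS (`Real.binEntropy` is in nats). [cite: MerkulovArnonFriedman2023, Lem 31] -/
noncomputable def h2 (x : ℝ) : ℝ := Real.binEntropy x / Real.log 2

/-- MAF23 eq. (18): `A(c) := 10 / (2c − 1)²` (meaningful for `c ∈ (1/2, 1]`; Lean junk `A(1/2) = 0`).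
[cite: MerkulovArnonFriedman2023, Lem 31 eq. (18)] -/
noncomputable def A (c : ℝ) : ℝ := 10 / (2 * c - 1) ^ 2

/-- The prefactor `max{0, 1 − √2·A(c)·(1−ω_p)^{1/4} − A(c)·√(1−ω_m)}` of eq. (17) (coefficient `√2·A(c)`,
see the module docstring's transcription note). [cite: MerkulovArnonFriedman2023, Lem 31 eq. (17)] -/
noncomputable def prefactor (ωp ωm c : ℝ) : ℝ :=
  max 0 (1 - Real.sqrt 2 * A c * (1 - ωp) ^ ((1 : ℝ) / 4) - A c * Real.sqrt (1 - ωm))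

/-- MAF23 Lemma 31, eq. (17) WITHOUT its `−ξ(λ)`: the single-round conditional von Neumann entropy lower
bound `g(ω_p, ω_m, c)` of the simplified device, as a real function of the two winning probabilities and
the overlap parameter `c ∈ (1/2, 1]`:
`prefactor · (log₂(1/c) − h(ω_m − 2√(1−ω_p) − √2·A(c)·(1−ω_p)^{1/4} − A(c)·√(1−ω_m)))`
`− √(1−ω_p)·log₂ 3 − (1 + √(1−ω_p))·h(√(1−ω_p)/(1 + √(1−ω_p)))`.
The paper's standing assumption that the `h`-argument is `≥ 1/2` is NOT built in.
[cite: MerkulovArnonFriedman2023, Lem 31 eq. (17)] -/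
noncomputable def gLemma31 (ωp ωm c : ℝ) : ℝ :=
  prefactor ωp ωm c *
      (Real.logb 2 (1 / c) -
        h2 (ωm - 2 * Real.sqrt (1 - ωp) - Real.sqrt 2 * A c * (1 - ωp) ^ ((1 : ℝ) / 4) -
          A c * Real.sqrt (1 - ωm)))
    - Real.sqrt (1 - ωp) * Real.logb 2 3
    - (1 + Real.sqrt (1 - ωp)) * h2 (Real.sqrt (1 - ωp) / (1 + Real.sqrt (1 - ωp)))

/-- `A(c) ≥ 10` on the admissible range `c ∈ (1/2, 1]` (since `0 < (2c−1)² ≤ 1`); arithmetic on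
[cite: MerkulovArnonFriedman2023, Lem 31 eq. (18)]. -/
theorem ten_le_A {c : ℝ} (hc : 1 / 2 < c) (hc1 : c ≤ 1) : 10 ≤ A c := by
  unfold A
  have hpos : 0 < 2 * c - 1 := by linarith
  have h0 : 0 < (2 * c - 1) ^ 2 := pow_pos hpos 2
  have h1 : (2 * c - 1) ^ 2 ≤ 1 := by nlinarith
  rw [le_div_iff₀ h0]
  nlinarith

/-- `A(c) > 0` for `c ≠ 1/2`; arithmetic on [cite: MerkulovArnonFriedman2023, Lem 31 eq. (18)]. -/
theorem A_pos {c : ℝ} (hc : 1 / 2 < c) : 0 < A c := by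
  unfold A
  exact div_pos (by norm_num) (pow_pos (by linarith) 2)

/-- **Dead zone of the printed prefactor**: for every `c ∈ (1/2, 1]`, every `ω_m` and every
`ω_p ≤ 1 − 1/40000` (i.e. `(1−ω_p)^{1/4} ≥ (10√2)⁻¹`), `√2·A(c)·(1−ω_p)^{1/4} ≥ √2·10·(10√2)⁻¹ = 1`, so
the prefactor `max{0, …}` of eq. (17) is `0`.  Arithmetic consequence of
[cite: MerkulovArnonFriedman2023, Lem 31 eq. (17)–(18)] (recorded for qa-cr line L-05). -/
theorem prefactor_eq_zero {ωp c : ℝ} (ωm : ℝ) (hωp : ωp ≤ 1 - 1 / 40000)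
    (hc : 1 / 2 < c) (hc1 : c ≤ 1) : prefactor ωp ωm c = 0 := by
  unfold prefactor
  apply max_eq_left
  have hA := ten_le_A hc hc1
  have hA0 : 0 ≤ A c := (A_pos hc).le
  -- `(1 − ω_p)^{1/4} ≥ (1/40000)^{1/4} = 1/(10 √2)`
  have hx : (1 / 40000 : ℝ) ^ ((1 : ℝ) / 4) ≤ (1 - ωp) ^ ((1 : ℝ) / 4) :=
    Real.rpow_le_rpow (by norm_num) (by linarith) (by norm_num)
  have hq : (1 / 40000 : ℝ) ^ ((1 : ℝ) / 4) = 1 / (10 * Real.sqrt 2) := by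
    have hs : (10 * Real.sqrt 2) ^ (4 : ℕ) = 40000 := by
      have h2 : Real.sqrt 2 ^ 2 = 2 := Real.sq_sqrt (by norm_num)
      calc (10 * Real.sqrt 2) ^ (4 : ℕ) = 10 ^ 4 * (Real.sqrt 2 ^ 2) ^ 2 := by ring
        _ = 40000 := by rw [h2]; norm_num
    have hpos : 0 < 10 * Real.sqrt 2 := by positivity
    rw [show (1 / 40000 : ℝ) = (1 / (10 * Real.sqrt 2)) ^ (4 : ℕ) by
      rw [div_pow, hs, one_pow]]
    rw [← Real.rpow_natCast, ← Real.rpow_mul (by positivity)]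
    norm_num
  have h1 : 1 ≤ Real.sqrt 2 * A c * (1 - ωp) ^ ((1 : ℝ) / 4) := by
    calc (1 : ℝ) = Real.sqrt 2 * 10 * (1 / (10 * Real.sqrt 2)) := by
          field_simp
      _ ≤ Real.sqrt 2 * A c * (1 - ωp) ^ ((1 : ℝ) / 4) := by
          rw [← hq]
          apply mul_le_mul _ hx (by positivity) (by positivity)
          exact mul_le_mul_of_nonneg_left hA (Real.sqrt_nonneg 2)
  have h3 : 0 ≤ A c * Real.sqrt (1 - ωm) := mul_nonneg hA0 (Real.sqrt_nonneg _)
  linarith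

/-- In the dead zone the printed bound (17) collapses to its continuity penalty:
`g(ω_p, ω_m, c) = −√(1−ω_p)·log₂ 3 − (1 + √(1−ω_p))·h(√(1−ω_p)/(1+√(1−ω_p)))`.
Arithmetic consequence of [cite: MerkulovArnonFriedman2023, Lem 31 eq. (17)–(18)]. -/
theorem gLemma31_eq_of_deadZone {ωp c : ℝ} (ωm : ℝ) (hωp : ωp ≤ 1 - 1 / 40000)
    (hc : 1 / 2 < c) (hc1 : c ≤ 1) :
    gLemma31 ωp ωm c = -(Real.sqrt (1 - ωp) * Real.logb 2 3) -
      (1 + Real.sqrt (1 - ωp)) * h2 (Real.sqrt (1 - ωp) / (1 + Real.sqrt (1 - ωp))) := by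
  unfold gLemma31
  rw [prefactor_eq_zero ωm hωp hc hc1]
  ring

/-- In the dead zone the printed bound (17) is `≤ 0` (both penalty terms are nonnegative: `log₂ 3 > 0`
and `h ≥ 0` on `[0,1]`), for EVERY overlap parameter `c ∈ (1/2,1]` and every `ω_m` — so the optimised
`max_c g` of eq. (27) is `≤ 0` there as well, and so is `g(ω;β)` of eq. (28) whenever an admissible
`ω_p ≤ 1 − 1/40000` exists.
Arithmetic consequence of [cite: MerkulovArnonFriedman2023, Lem 31 eq. (17)–(18)]. -/
theorem gLemma31_nonpos_of_deadZone {ωp c : ℝ} (ωm : ℝ) (hωp : ωp ≤ 1 - 1 / 40000)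
    (hc : 1 / 2 < c) (hc1 : c ≤ 1) : gLemma31 ωp ωm c ≤ 0 := by
  rw [gLemma31_eq_of_deadZone ωm hωp hc hc1]
  set r := Real.sqrt (1 - ωp) with hr
  have hr0 : 0 ≤ r := Real.sqrt_nonneg _
  have hlog3 : 0 ≤ Real.logb 2 3 := Real.logb_nonneg (by norm_num) (by norm_num)
  have hh : 0 ≤ h2 (r / (1 + r)) := by
    unfold h2
    refine div_nonneg (Real.binEntropy_nonneg (div_nonneg hr0 (by linarith)) ?_) (Real.log_pos (by norm_num)).le
    rw [div_le_one (by linarith)]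
    linarith
  nlinarith [mul_nonneg hr0 hlog3, mul_nonneg (by linarith : (0:ℝ) ≤ 1 + r) hh]

/-! ## §3 Lemma 33 and Theorem 34 -/

/-- MAF23 eq. (30) (Lemma 33): the min-tradeoff value `f_min = (g(ω; β) − ξ(λ)) · (1 − β γ)` built from a
single-round bound value `g`, the negligible term `ξ` and the test/no-abort parameters `β, γ ∈ (0,1)`.
[cite: MerkulovArnonFriedman2023, Lem 33 eq. (30)] -/
def fmin (g ξ β γ : ℝ) : ℝ := (g - ξ) * (1 - β * γ)

/-- MAF23 Theorem 34, right-hand side, as a function of the accumulation rate `μ_opt` (itself an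
optimisation the paper evaluates numerically) and the parameters:
`n (μ_opt − ξ − γ) − 2 log₂ 7 · √(1 − 2 log₂(ε_s/4 · p_Ω)) − 3 log₂(1 − √(1 − (ε_s/4)²))`.
[cite: MerkulovArnonFriedman2023, Thm 34] -/
noncomputable def thm34Bound (n : ℕ) (μopt ξ γ εs pΩ : ℝ) : ℝ :=
  n * (μopt - ξ - γ) - 2 * Real.logb 2 7 * Real.sqrt (1 - 2 * Real.logb 2 (εs / 4 * pΩ))
    - 3 * Real.logb 2 (1 - Real.sqrt (1 - (εs / 4) ^ 2))

/-- Theorem 34's bound is monotone in the accumulation rate `μ_opt` (so any UPPER bound on `μ_opt`, e.g.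
from a single-round dead zone, bounds the certified amount from above). Arithmetic on
[cite: MerkulovArnonFriedman2023, Thm 34]. -/
theorem thm34Bound_mono (n : ℕ) {μ₁ μ₂ : ℝ} (h : μ₁ ≤ μ₂) (ξ γ εs pΩ : ℝ) :
    thm34Bound n μ₁ ξ γ εs pΩ ≤ thm34Bound n μ₂ ξ γ εs pΩ := by
  unfold thm34Bound
  have hn : (0 : ℝ) ≤ n := Nat.cast_nonneg n
  nlinarith [mul_le_mul_of_nonneg_left h hn]


/-! ## §4 Further arithmetic on the printed forms (appended; serves line L-05's S-sized conjuncts) -/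

/-- In the dead zone the printed single-round bound (17) is STRICTLY negative: `ω_p ≤ 1 − 1/40000 < 1`
makes the continuity penalty `√(1−ω_p)·log₂ 3` strictly positive. Arithmetic consequence of
[cite: MerkulovArnonFriedman2023, Lem 31 eq. (17)–(18)]. -/
theorem gLemma31_neg_of_deadZone {ωp c : ℝ} (ωm : ℝ) (hωp : ωp ≤ 1 - 1 / 40000)
    (hc : 1 / 2 < c) (hc1 : c ≤ 1) : gLemma31 ωp ωm c < 0 := by
  rw [gLemma31_eq_of_deadZone ωm hωp hc hc1]
  set r := Real.sqrt (1 - ωp) with hr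
  have hr0 : 0 < r := Real.sqrt_pos.mpr (by linarith)
  have hlog3 : 0 < Real.logb 2 3 := Real.logb_pos (by norm_num) (by norm_num)
  have hh : 0 ≤ h2 (r / (1 + r)) := by
    unfold h2
    refine div_nonneg (Real.binEntropy_nonneg (div_nonneg hr0.le (by linarith)) ?_)
      (Real.log_pos (by norm_num)).le
    rw [div_le_one (by linarith)]
    linarith
  nlinarith [mul_pos hr0 hlog3, mul_nonneg (by linarith : (0:ℝ) ≤ 1 + r) hh]

/-- The second-order coefficient dominates twice the gradient ceiling: for `d_O ≥ 0`, `‖∇f‖_∞ ≥ 0` and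
`ε_s, p_Ω ∈ (0, 1]` one has `log₂(1 + 2 d_O) ≥ 0` and `√(1 − 2 log₂(ε_s p_Ω)) ≥ 1`, hence
`μ ≥ 2⌈‖∇f‖_∞⌉`. Arithmetic on [cite: MerkulovArnonFriedman2023, Thm 18 eq. (14)]. -/
theorem two_ceil_le_mu {dO grad εs pΩ : ℝ} (hdO : 0 ≤ dO) (hgrad : 0 ≤ grad) (hε : 0 < εs)
    (hε1 : εs ≤ 1) (hp : 0 < pΩ) (hp1 : pΩ ≤ 1) : 2 * (⌈grad⌉ : ℝ) ≤ mu dO grad εs pΩ := by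
  unfold mu
  have hlog : 0 ≤ Real.logb 2 (1 + 2 * dO) := Real.logb_nonneg (by norm_num) (by linarith)
  have hprod : εs * pΩ ≤ 1 := by nlinarith
  have hlb : Real.logb 2 (εs * pΩ) ≤ 0 :=
    Real.logb_nonpos (by norm_num) (mul_pos hε hp).le hprod
  have hsqrt : 1 ≤ Real.sqrt (1 - 2 * Real.logb 2 (εs * pΩ)) := by
    have h := Real.sqrt_le_sqrt (show (1 : ℝ) ≤ 1 - 2 * Real.logb 2 (εs * pΩ) by linarith)
    rwa [Real.sqrt_one] at h
  have hg : 0 ≤ (⌈grad⌉ : ℝ) := by exact_mod_cast Int.ceil_nonneg hgrad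
  calc 2 * (⌈grad⌉ : ℝ) = 2 * ⌈grad⌉ * 1 := by ring
    _ ≤ 2 * (Real.logb 2 (1 + 2 * dO) + ⌈grad⌉) * Real.sqrt (1 - 2 * Real.logb 2 (εs * pΩ)) :=
        mul_le_mul (by linarith) hsqrt zero_le_one (by linarith)

/-- **Gradient-driven finite-size threshold**: with `0 < t ≤ log₂ 3` (the single-round bound never
exceeds `log₂ 3`... here only `t ≤ log₂ 3` is used), `d_O ≥ 0`, `‖∇f‖_∞ ≥ 0` and `ε_s, p_Ω ∈ (0,1]`,
`N₀ = (μ/t)² ≥ (2⌈‖∇f‖_∞⌉ / log₂ 3)²`. Arithmetic on [cite: MerkulovArnonFriedman2023, Thm 18 eq. (13)–(14)]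
(this is line L-05's conjunct `N0LowerBound`). -/
theorem N0_ge_gradient_bound {t dO grad εs pΩ : ℝ} (ht : 0 < t) (ht3 : t ≤ Real.logb 2 3)
    (hdO : 0 ≤ dO) (hgrad : 0 ≤ grad) (hε : 0 < εs) (hε1 : εs ≤ 1) (hp : 0 < pΩ) (hp1 : pΩ ≤ 1) :
    (2 * (⌈grad⌉ : ℝ) / Real.logb 2 3) ^ 2 ≤ N0 t dO grad εs pΩ := by
  unfold N0
  have hμ := two_ceil_le_mu hdO hgrad hε hε1 hp hp1
  have hg0 : 0 ≤ (⌈grad⌉ : ℝ) := by exact_mod_cast Int.ceil_nonneg hgrad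
  have hlog3 : 0 < Real.logb 2 3 := Real.logb_pos (by norm_num) (by norm_num)
  have h1 : 2 * (⌈grad⌉ : ℝ) / Real.logb 2 3 ≤ mu dO grad εs pΩ / t := by
    calc 2 * (⌈grad⌉ : ℝ) / Real.logb 2 3 ≤ 2 * ⌈grad⌉ / t :=
          div_le_div_of_nonneg_left (by linarith) ht ht3
      _ ≤ mu dO grad εs pΩ / t := div_le_div_of_nonneg_right hμ ht.le
  have h0 : 0 ≤ 2 * (⌈grad⌉ : ℝ) / Real.logb 2 3 := div_nonneg (by linarith) hlog3.le
  exact pow_le_pow_left₀ h0 h1 2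


/-! ## §5 The entropy-positive window is non-empty at `1 − ω_p = 10⁻¹²` (appended) -/


/-- `h(y) ≤ (1 − y)(1 + log (1−y)⁻¹)` (nats) for `0 < y`: `−y log y ≤ 1 − y` (plumbing). [folklore] -/
private theorem binEntropy_le_near_one {y : ℝ} (hy0 : 0 < y) :
    Real.binEntropy y ≤ (1 - y) * (1 + Real.log (1 - y)⁻¹) := by
  unfold Real.binEntropy
  have h1 : Real.log y⁻¹ ≤ y⁻¹ - 1 := Real.log_le_sub_one_of_pos (inv_pos.mpr hy0)
  have h2 : y * Real.log y⁻¹ ≤ 1 - y := by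
    calc y * Real.log y⁻¹ ≤ y * (y⁻¹ - 1) := mul_le_mul_of_nonneg_left h1 hy0.le
      _ = 1 - y := by field_simp
  nlinarith [h2]

/-- `log t ≤ 4 log 2 + (t/16 − 1)` for `t > 0` (plumbing). [folklore] -/
private theorem log_le_four_log_two {t : ℝ} (ht : 0 < t) : Real.log t ≤ 4 * Real.log 2 + (t / 16 - 1) := by
  have h16 : Real.log t = Real.log 16 + Real.log (t / 16) := by
    rw [← Real.log_mul (by norm_num) (by positivity)]; congr 1; ring
  rw [h16, show (16:ℝ) = 2 ^ 4 by norm_num, Real.log_pow]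
  push_cast
  linarith [Real.log_le_sub_one_of_pos (show 0 < t / 16 by positivity)]

/-- `1.4142 < √2 < 1.4143` (plumbing). [folklore] -/
private theorem sqrt_two_bounds : 1.4142 < Real.sqrt 2 ∧ Real.sqrt 2 < 1.4143 := by
  constructor
  · rw [Real.lt_sqrt (by norm_num)]; norm_num
  · rw [Real.sqrt_lt' (by norm_num)]; norm_num

/-- **The printed single-round bound is POSITIVE at `(ω_p, ω_m, c) = (1 − 10⁻¹², 1, 3/4)`** —
the entropy-positive window of eq. (17) is non-empty at `1 − ω_p = 10⁻¹²`, consistent with the paper's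
numerics («ω₀ ≥ 1 − 5·10⁻¹²», Fig. 5).  At this point `A = 40`, the prefactor is `1 − √2/25 ≈ 0.943`, the
`h`-argument is `1 − 2·10⁻⁶ − √2/25 ≈ 0.943 ≥ 1/2` (inside the printed regime where the `h`-step of the
proof of Lemma 31 is monotone, rand.tex l.452–453), `log₂(4/3) − h ≥ 0.36 − 0.3166`, and the continuity
penalty is `< 3·10⁻⁵`; so `g > 0.04 > 0`.  CAVEAT recorded for lines: outside that regime (h-argument
`< 1/2`) the unguarded closed form is not the paper's bound — e.g. at `(1 − 10⁻¹¹, 1, 0.583)` the formula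
evaluates to `≈ +0.03` with h-argument `≈ 0.087`; a line that brackets the window must use the guarded
reading (`h := 1` below `1/2`, always valid since `h ≤ 1`).  Arithmetic on
[cite: MerkulovArnonFriedman2023, Lem 31 eq. (17)–(18)] (serves L-05 leaf 2 `WindowOpenBelow`). -/
theorem gLemma31_pos_windowPoint : 0 < gLemma31 (1 - 1 / 10 ^ 12) 1 (3 / 4) := by
  have hlog2 := Real.log_two_gt_d9
  have hlog2' := Real.log_two_lt_d9
  have hlog2pos : 0 < Real.log 2 := by linarith
  obtain ⟨hs1, hs2⟩ := sqrt_two_bounds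
  -- evaluate the radicals
  have hx : (1 - (1 - 1 / 10 ^ 12 : ℝ)) ^ ((1 : ℝ) / 4) = 1 / 10 ^ 3 := by
    rw [show (1 - (1 - 1 / 10 ^ 12 : ℝ)) = (1 / 10 ^ 3) ^ (4 : ℕ) by norm_num,
      show ((1 : ℝ) / 4) = ((4 : ℕ) : ℝ)⁻¹ by norm_num]
    exact Real.pow_rpow_inv_natCast (by norm_num) (by norm_num)
  have hr : Real.sqrt (1 - (1 - 1 / 10 ^ 12 : ℝ)) = 1 / 10 ^ 6 := by
    rw [show (1 - (1 - 1 / 10 ^ 12 : ℝ)) = (1 / 10 ^ 6) ^ 2 by norm_num, Real.sqrt_sq (by norm_num)]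
  have hs : Real.sqrt (1 - (1 : ℝ)) = 0 := by simp
  have hA : A (3 / 4) = 40 := by norm_num [A]
  have hpref : prefactor (1 - 1 / 10 ^ 12) 1 (3 / 4) = 1 - Real.sqrt 2 / 25 := by
    unfold prefactor
    rw [hx, hs, hA, max_eq_right (by nlinarith)]
    ring
  unfold gLemma31
  rw [hpref, hx, hr, hs, hA]
  -- the argument of `h`
  set y : ℝ := 1 - 2 * (1 / 10 ^ 6) - Real.sqrt 2 * 40 * (1 / 10 ^ 3) - 40 * 0 with hy
  have hy_lo : (0.943426 : ℝ) ≤ y := by rw [hy]; nlinarith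
  have hy_hi : y ≤ 1 := by rw [hy]; nlinarith [Real.sqrt_nonneg 2]
  have hy_half : (2:ℝ)⁻¹ ≤ y := by linarith
  -- h(y) ≤ h(0.943426) ≤ 0.2194 nats
  have hhy : Real.binEntropy y ≤ Real.binEntropy 0.943426 :=
    Real.binEntropy_strictAntiOn.antitoneOn ⟨by norm_num, by norm_num⟩ ⟨hy_half, hy_hi⟩ hy_lo
  have hh0 : Real.binEntropy (0.943426 : ℝ) ≤ 0.2194 := by
    have h1 := binEntropy_le_near_one (y := (0.943426 : ℝ)) (by norm_num)
    have hl := log_le_four_log_two (t := (1 - (0.943426 : ℝ))⁻¹) (by norm_num)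
    norm_num at h1 hl ⊢
    nlinarith [hl, h1, hlog2']
  have hh2y : h2 y ≤ 0.3166 := by
    unfold h2
    rw [div_le_iff₀ hlog2pos]
    nlinarith [hhy, hh0, hlog2]
  -- log₂(4/3) ≥ 0.36
  have hL : (0.36 : ℝ) ≤ Real.logb 2 (1 / (3 / 4)) := by
    rw [Real.logb, le_div_iff₀ hlog2pos]
    have h := Real.one_sub_inv_le_log_of_pos (show (0 : ℝ) < 1 / (3 / 4) by norm_num)
    norm_num at h ⊢
    nlinarith [h, hlog2']
  -- penalty: log₂ 3 ≤ 2.886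
  have hlog3 : Real.logb 2 3 ≤ 2.886 := by
    rw [Real.logb, div_le_iff₀ hlog2pos]
    have h := Real.log_le_sub_one_of_pos (show (0 : ℝ) < 3 by norm_num)
    nlinarith [h, hlog2]
  -- penalty: h(10⁻⁶/(1+10⁻⁶)) tiny
  have hh2r : h2 (1 / 10 ^ 6 / (1 + 1 / 10 ^ 6)) ≤ 0.000022 := by
    have hyp : (1 / 10 ^ 6 / (1 + 1 / 10 ^ 6) : ℝ) = 1 / (10 ^ 6 + 1) := by
      field_simp
    unfold h2
    rw [div_le_iff₀ hlog2pos, hyp]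
    unfold Real.binEntropy
    have e0 : ((1 : ℝ) / (10 ^ 6 + 1))⁻¹ = 10 ^ 6 + 1 := by rw [one_div, inv_inv]
    have e1 : Real.log ((1 : ℝ) / (10 ^ 6 + 1))⁻¹ ≤ 20 * Real.log 2 := by
      rw [e0, show (20 : ℝ) * Real.log 2 = Real.log (2 ^ 20) by rw [Real.log_pow]; norm_num]
      exact Real.log_le_log (by norm_num) (by norm_num)
    have e2 : Real.log (1 - (1 : ℝ) / (10 ^ 6 + 1))⁻¹ ≤ (1 - (1 : ℝ) / (10 ^ 6 + 1))⁻¹ - 1 :=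
      Real.log_le_sub_one_of_pos (by norm_num)
    have e3 : (1 - (1 : ℝ) / (10 ^ 6 + 1)) * Real.log (1 - (1 : ℝ) / (10 ^ 6 + 1))⁻¹ ≤
        1 / (10 ^ 6 + 1) := by
      calc (1 - (1 : ℝ) / (10 ^ 6 + 1)) * Real.log (1 - (1 : ℝ) / (10 ^ 6 + 1))⁻¹
          ≤ (1 - (1 : ℝ) / (10 ^ 6 + 1)) * ((1 - (1 : ℝ) / (10 ^ 6 + 1))⁻¹ - 1) :=
            mul_le_mul_of_nonneg_left e2 (by norm_num)
        _ = 1 / (10 ^ 6 + 1) := by field_simp; ring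
    have e4 : (1 : ℝ) / (10 ^ 6 + 1) * Real.log ((1 : ℝ) / (10 ^ 6 + 1))⁻¹ ≤
        1 / (10 ^ 6 + 1) * (20 * Real.log 2) := mul_le_mul_of_nonneg_left e1 (by norm_num)
    nlinarith [e3, e4, hlog2']
  -- assemble
  have hP : (0.9434 : ℝ) ≤ 1 - Real.sqrt 2 / 25 := by nlinarith
  have hF : (0.0434 : ℝ) ≤ Real.logb 2 (1 / (3 / 4)) - h2 y := by linarith
  have hprod : (0.9434 : ℝ) * 0.0434 ≤ (1 - Real.sqrt 2 / 25) * (Real.logb 2 (1 / (3 / 4)) - h2 y) :=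
    mul_le_mul hP hF (by norm_num) (by linarith)
  have hpen0 : 0 ≤ h2 (1 / 10 ^ 6 / (1 + 1 / 10 ^ 6)) := by
    unfold h2
    refine div_nonneg (Real.binEntropy_nonneg (by norm_num) (by norm_num)) hlog2pos.le
  nlinarith [hprod, hlog3, hh2r, hpen0]




/-! ## §6 The printed bound is negative for `1 − ω_p ≥ 10⁻¹¹` throughout the printed regime (appended) -/


/-- Series upper bound `log a⁻¹ ≤ Σ_{i ≤ 5} (1−a)ⁱ/i + (1−a)⁶/a` for `a ∈ (0,1]` (plumbing;
`Real.abs_log_sub_add_sum_range_le`). [folklore] -/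
private theorem log_inv_le_series {a : ℝ} (ha : 0 < a) (ha1 : a ≤ 1) :
    Real.log a⁻¹ ≤ (1 - a) + (1 - a) ^ 2 / 2 + (1 - a) ^ 3 / 3 + (1 - a) ^ 4 / 4 + (1 - a) ^ 5 / 5
      + (1 - a) ^ 6 / a := by
  have hx : |1 - a| < 1 := by rw [abs_lt]; constructor <;> linarith
  have h := Real.abs_log_sub_add_sum_range_le hx 5
  rw [abs_of_nonneg (by linarith : (0:ℝ) ≤ 1 - a)] at h
  have h' := (abs_le.mp h).1
  simp only [Finset.sum_range_succ, Finset.sum_range_zero, sub_sub_cancel] at h'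
  norm_num at h'
  rw [Real.log_inv]
  linarith

/-- Tangent-plus-series lower bound for the binary entropy (nats): for `0 < d < 1` and every `k : ℕ`,
`d (k log 2 + 1 − 2ᵏ d) + (d − d²/2 − d³/6 − (4/3) d⁴) ≤ h(d)` (tangent of `−log` at `2⁻ᵏ`; three terms
of the series of `−log(1−d)`) (plumbing). [folklore] -/
private theorem binEntropy_ge_poly {d : ℝ} (k : ℕ) (hd0 : 0 < d) (hd1 : d < 1) :
    d * (k * Real.log 2 + 1 - 2 ^ k * d) + (d - d ^ 2 / 2 - d ^ 3 / 6 - 4 / 3 * d ^ 4)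
      ≤ Real.binEntropy d := by
  unfold Real.binEntropy
  have h1 : k * Real.log 2 + 1 - 2 ^ k * d ≤ Real.log d⁻¹ := by
    have := Real.log_le_sub_one_of_pos (show 0 < 2 ^ k * d by positivity)
    rw [Real.log_mul (by positivity) hd0.ne', Real.log_pow] at this
    rw [Real.log_inv]; linarith
  have h1d : 0 < 1 - d := by linarith
  have h2' : d - d ^ 2 / 2 - d ^ 3 / 6 - 4 / 3 * d ^ 4 ≤ (1 - d) * Real.log (1 - d)⁻¹ := by
    have hx : |d| < 1 := by rw [abs_lt]; constructor <;> linarith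
    have h := Real.abs_log_sub_add_sum_range_le hx 3
    rw [abs_of_pos hd0] at h
    have h' := (abs_le.mp h).2
    simp only [Finset.sum_range_succ, Finset.sum_range_zero] at h'
    norm_num at h'
    have hq : d ^ 4 / (1 - d) * (1 - d) = d ^ 4 := div_mul_cancel₀ _ h1d.ne'
    rw [Real.log_inv]
    nlinarith [mul_le_mul_of_nonneg_right h' h1d.le]
  have h3 : d * (k * Real.log 2 + 1 - 2 ^ k * d) ≤ d * Real.log d⁻¹ :=
    mul_le_mul_of_nonneg_left h1 hd0.le
  linarith

/-- One cell `[a, b]` of the monotone partition behind `log_inv_lt_binEntropy_regime`: `log(1/c) ≤ log(1/a)`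
and `h(0.02514/(2c−1)²) ≥ h(0.02514/(2b−1)²)`, the two ends compared by `hnum` (plumbing). [folklore] -/
private theorem regime_cell (a b : ℝ) (k : ℕ) {c : ℝ} (hac : a ≤ c) (hcb : c ≤ b) (ha : 1 / 2 < a)
    (hb1 : b ≤ 1) (hdc : 0.02514 / (2 * c - 1) ^ 2 ≤ 1 / 2)
    (hnum : (1 - a) + (1 - a) ^ 2 / 2 + (1 - a) ^ 3 / 3 + (1 - a) ^ 4 / 4 + (1 - a) ^ 5 / 5
        + (1 - a) ^ 6 / a <
      0.02514 / (2 * b - 1) ^ 2 * (k * Real.log 2 + 1 - 2 ^ k * (0.02514 / (2 * b - 1) ^ 2)) +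
        (0.02514 / (2 * b - 1) ^ 2 - (0.02514 / (2 * b - 1) ^ 2) ^ 2 / 2
          - (0.02514 / (2 * b - 1) ^ 2) ^ 3 / 6 - 4 / 3 * (0.02514 / (2 * b - 1) ^ 2) ^ 4)) :
    Real.log c⁻¹ < Real.binEntropy (0.02514 / (2 * c - 1) ^ 2) := by
  have hsc : 0 < 2 * c - 1 := by linarith
  have hsb : 0 < 2 * b - 1 := by linarith
  have hdb_le : 0.02514 / (2 * b - 1) ^ 2 ≤ 0.02514 / (2 * c - 1) ^ 2 := by
    apply div_le_div_of_nonneg_left (by norm_num) (by positivity)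
    nlinarith
  have hdb_pos : (0:ℝ) < 0.02514 / (2 * b - 1) ^ 2 := by positivity
  have hdb_lt : 0.02514 / (2 * b - 1) ^ 2 < (1:ℝ) := by linarith
  have hL : Real.log c⁻¹ ≤ Real.log a⁻¹ :=
    Real.log_le_log (inv_pos.mpr (by linarith)) ((inv_le_inv₀ (by linarith) (by linarith)).mpr hac)
  have hLa := log_inv_le_series (a := a) (by linarith) (by linarith)
  have hHb := binEntropy_ge_poly k hdb_pos hdb_lt
  have hmono : Real.binEntropy (0.02514 / (2 * b - 1) ^ 2) ≤
      Real.binEntropy (0.02514 / (2 * c - 1) ^ 2) :=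
    Real.binEntropy_strictMonoOn.monotoneOn ⟨hdb_pos.le, by norm_num at hdb_le hdc ⊢; linarith⟩
      ⟨by positivity, by norm_num at hdc ⊢; linarith⟩ hdb_le
  linarith

/-- The one-variable inequality behind the closed window (nats): for `c ∈ (1/2, 1]` with
`0.02514/(2c−1)² ≤ 1/2` (equivalently `c ≥ 0.6121…`), `log(1/c) < h(0.02514/(2c−1)²)`; the minimum
margin is `≈ 0.030` nats (`≈ 0.043` bits) near `c ≈ 0.79`.  Ten-cell monotone partition of
`[0.6121, 1]`, each cell closed by `regime_cell` with the nine-digit `log 2` (plumbing). [folklore] -/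
private theorem log_inv_lt_binEntropy_regime {c : ℝ} (hc : 1 / 2 < c) (hc1 : c ≤ 1)
    (hdc : 0.02514 / (2 * c - 1) ^ 2 ≤ 1 / 2) :
    Real.log c⁻¹ < Real.binEntropy (0.02514 / (2 * c - 1) ^ 2) := by
  have hlog2 := Real.log_two_gt_d9
  have hsc : 0 < 2 * c - 1 := by linarith
  have hcs : 0.05028 ≤ (2 * c - 1) ^ 2 := by
    rw [div_le_iff₀ (by positivity)] at hdc; linarith
  have hclo : 0.6121 ≤ c := by nlinarith
  rcases le_or_gt c 0.676 with h₁ | h₁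
  · exact regime_cell 0.6121 0.676 2 hclo h₁ (by norm_num) (by norm_num) hdc (by norm_num; linarith)
  rcases le_or_gt c 0.716 with h₂ | h₂
  · exact regime_cell 0.676 0.716 3 h₁.le h₂ (by norm_num) (by norm_num) hdc (by norm_num; linarith)
  rcases le_or_gt c 0.744 with h₃ | h₃
  · exact regime_cell 0.716 0.744 3 h₂.le h₃ (by norm_num) (by norm_num) hdc (by norm_num; linarith)
  rcases le_or_gt c 0.765 with h₄ | h₄
  · exact regime_cell 0.744 0.765 3 h₃.le h₄ (by norm_num) (by norm_num) hdc (by norm_num; linarith)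
  rcases le_or_gt c 0.786 with h₅ | h₅
  · exact regime_cell 0.765 0.786 4 h₄.le h₅ (by norm_num) (by norm_num) hdc (by norm_num; linarith)
  rcases le_or_gt c 0.81 with h₆ | h₆
  · exact regime_cell 0.786 0.81 4 h₅.le h₆ (by norm_num) (by norm_num) hdc (by norm_num; linarith)
  rcases le_or_gt c 0.839 with h₇ | h₇
  · exact regime_cell 0.81 0.839 4 h₆.le h₇ (by norm_num) (by norm_num) hdc (by norm_num; linarith)
  rcases le_or_gt c 0.881 with h₈ | h₈
  · exact regime_cell 0.839 0.881 5 h₇.le h₈ (by norm_num) (by norm_num) hdc (by norm_num; linarith)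
  rcases le_or_gt c 0.975 with h₉ | h₉
  · exact regime_cell 0.881 0.975 5 h₈.le h₉ (by norm_num) (by norm_num) hdc (by norm_num; linarith)
  · exact regime_cell 0.975 1 5 h₉.le hc1 (by norm_num) (by norm_num) hdc (by norm_num; linarith)

/-- **The printed single-round bound (17) is NEGATIVE whenever `1 − ω_p ≥ 10⁻¹¹`, for every
`c ∈ (1/2, 1]` and every `ω_m ≤ 1`, throughout the printed regime** (the `h`-argument
`ω_m − 2√(1−ω_p) − √2·A(c)·(1−ω_p)^{1/4} − A(c)·√(1−ω_m) ≥ 1/2`, rand.tex l.452–453) — the closed side of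
the window whose open point is `gLemma31_pos_windowPoint` (`1 − ω_p = 10⁻¹²`), consistent with the paper's
own requirement «ω₀ ≥ 1 − 5·10⁻¹²» (numerics of Thm 34 / Fig. 5).  Proof: the deficit
`D := 1 − (h-argument) ≥ √2·A(c)·(1−ω_p)^{1/4} ≥ √2·10·10^{−11/4}/(2c−1)² ≥ 0.02514/(2c−1)²` and
`D ≤ 1/2`, so `h(h-argument) = h(D) ≥ h(0.02514/(2c−1)²) > log₂(1/c)` by `log_inv_lt_binEntropy_regime`
(minimum margin `≈ 0.043` bits near `c ≈ 0.79`); the prefactor equals `(h-argument) + (1−ω_m) + 2√(1−ω_p)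
≥ 1/2 > 0`, and the continuity penalty `√(1−ω_p)·log₂3 + (1+√(1−ω_p))·h(·)` is `> 0`.  OUTSIDE the
regime the unguarded formula is not negative at `10⁻¹¹` (e.g. `≈ +0.03` at `(1 − 10⁻¹¹, 1, 0.583)`, where
the `h`-argument is `≈ 0.087 < 1/2`; see the caveat at `gLemma31_pos_windowPoint`): a line's guarded
reading (`h := 1` below `1/2`) handles that branch in one line (`log₂(1/c) − 1 < 0`).  Arithmetic on
[cite: MerkulovArnonFriedman2023, Lem 31 eq. (17)–(18)] (serves L-05 leaf 2 `WindowClosedAbove`). -/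
theorem gLemma31_neg_of_regime {ωp ωm c : ℝ} (hωp : ωp ≤ 1 - 1 / 10 ^ 11) (hc : 1 / 2 < c)
    (hc1 : c ≤ 1) (hωm : ωm ≤ 1)
    (hreg : 1 / 2 ≤ ωm - 2 * Real.sqrt (1 - ωp) - Real.sqrt 2 * A c * (1 - ωp) ^ ((1 : ℝ) / 4)
      - A c * Real.sqrt (1 - ωm)) :
    gLemma31 ωp ωm c < 0 := by
  obtain ⟨hs1, hs2⟩ := sqrt_two_bounds
  have hlog2pos : 0 < Real.log 2 := Real.log_pos one_lt_two
  unfold gLemma31 prefactor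
  set x : ℝ := 1 - ωp with hx
  set u : ℝ := x ^ ((1 : ℝ) / 4) with hu
  set r : ℝ := Real.sqrt (1 - ωm) with hr
  set inner : ℝ := ωm - 2 * Real.sqrt x - Real.sqrt 2 * A c * u - A c * r with hinner
  have hx0 : 1 / 10 ^ 11 ≤ x := by rw [hx]; linarith
  have hxpos : 0 < x := by linarith
  -- the fourth root is at least 0.0017782 (`0.0017782⁴ ≤ 10⁻¹¹`)
  have hu0 : 0.0017782 ≤ u := by
    have h1 : (0.0017782 : ℝ) = ((0.0017782 : ℝ) ^ (4:ℕ)) ^ ((1 : ℝ) / 4) := by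
      rw [show ((1 : ℝ) / 4) = ((4 : ℕ) : ℝ)⁻¹ by norm_num]
      exact (Real.pow_rpow_inv_natCast (by norm_num) (by norm_num)).symm
    rw [h1, hu]
    exact Real.rpow_le_rpow (by norm_num) (by norm_num at hx0 ⊢; linarith) (by norm_num)
  have hsc : 0 < 2 * c - 1 := by linarith
  have hApos : 0 < A c := A_pos hc
  have hr0 : 0 ≤ r := Real.sqrt_nonneg _
  have hsx : 0 ≤ Real.sqrt x := Real.sqrt_nonneg _
  -- the deficit `1 − inner` dominates `√2·A(c)·u ≥ 0.02514/(2c−1)²`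
  have hD : 0.02514 / (2 * c - 1) ^ 2 ≤ 1 - inner := by
    have hkey : 0.02514 / (2 * c - 1) ^ 2 ≤ Real.sqrt 2 * A c * u := by
      have hAu : Real.sqrt 2 * A c * u = Real.sqrt 2 * 10 * u / (2 * c - 1) ^ 2 := by
        unfold A; field_simp
      rw [hAu]
      apply div_le_div_of_nonneg_right _ (by positivity)
      nlinarith
    have : Real.sqrt 2 * A c * u ≤ 1 - inner := by
      rw [hinner]; nlinarith [mul_nonneg hApos.le hr0]
    linarith
  have hDhalf : 1 - inner ≤ 1 / 2 := by linarith
  have hdc : 0.02514 / (2 * c - 1) ^ 2 ≤ 1 / 2 := hD.trans hDhalf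
  have hcore := log_inv_lt_binEntropy_regime hc hc1 hdc
  have hmono : Real.binEntropy (0.02514 / (2 * c - 1) ^ 2) ≤ Real.binEntropy (1 - inner) :=
    Real.binEntropy_strictMonoOn.monotoneOn ⟨by positivity, by norm_num at hdc ⊢; linarith⟩
      ⟨le_trans (by positivity) hD, by norm_num at hDhalf ⊢; linarith⟩ hD
  rw [Real.binEntropy_one_sub] at hmono
  -- the bracket `log₂(1/c) − h(inner)` is negative
  have hbr : Real.logb 2 (1 / c) - h2 inner < 0 := by
    unfold h2
    rw [Real.logb, one_div, sub_neg, div_lt_div_iff_of_pos_right hlog2pos]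
    linarith
  -- the prefactor is positive (it exceeds the `h`-argument)
  have hPpos : 0 < 1 - Real.sqrt 2 * A c * u - A c * r := by
    have : ωm - 2 * Real.sqrt x ≤ 1 := by linarith
    linarith
  rw [max_eq_right hPpos.le]
  -- the continuity penalty is nonnegative, its first term strictly positive
  have ht1 : 0 < Real.sqrt x * Real.logb 2 3 :=
    mul_pos (Real.sqrt_pos.mpr hxpos) (Real.logb_pos (by norm_num) (by norm_num))
  have ht2 : 0 ≤ (1 + Real.sqrt x) * h2 (Real.sqrt x / (1 + Real.sqrt x)) := by
    apply mul_nonneg (by positivity)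
    unfold h2
    refine div_nonneg (Real.binEntropy_nonneg (by positivity) ?_) hlog2pos.le
    rw [div_le_one (by positivity)]; linarith
  nlinarith [mul_neg_of_pos_of_neg hPpos hbr]

/-- Numerical size of the printed continuity-penalty constant: `log₂ 3 < 1.586` (series for `log(3/2)`
against the nine-digit `log 2`); with `N0_ge_gradient_bound` it turns a gradient ceiling `⌈‖∇f‖∞⌉ ≥ k`
into the explicit round threshold `N₀ ≥ (2k/1.586)²`.  Arithmetic on the constant of
[cite: MerkulovArnonFriedman2023, Lem 31 eq. (17)–(18)] (serves L-05 `ZhuBelowThreshold`). -/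
theorem logb_two_three_lt : Real.logb 2 3 < 1.586 := by
  have hlog2 := Real.log_two_gt_d9
  have hlog2pos : 0 < Real.log 2 := by linarith
  rw [Real.logb, div_lt_iff₀ hlog2pos]
  have h3 : Real.log 3 = Real.log 2 + Real.log (3 / 2) := by
    rw [← Real.log_mul (by norm_num) (by norm_num)]; norm_num
  have hx : |(1:ℝ) / 3| < 1 := by rw [abs_of_pos (by norm_num)]; norm_num
  have h := Real.abs_log_sub_add_sum_range_le hx 8
  rw [abs_of_pos (by norm_num : (0:ℝ) < 1 / 3)] at h
  have h' := (abs_le.mp h).1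
  simp only [Finset.sum_range_succ, Finset.sum_range_zero] at h'
  norm_num at h'
  have h32 : Real.log (3 / 2) = - Real.log (2 / 3) := by
    rw [← Real.log_inv]; norm_num
  rw [h3, h32]
  linarith

/-- Corollary for round counts: under the hypotheses of `N0_ge_gradient_bound`, a gradient ceiling
`⌈‖∇f‖∞⌉ ≥ 184` forces `N₀ > 53550` (`(368/log₂3)² ≥ (368/1.586)² ≈ 53 838`).  Arithmetic on
[cite: MerkulovArnonFriedman2023, Thm 18 eq. (13)–(14)] with the constant of Lem 31 (serves L-05
`ZhuBelowThreshold`, whose `53 550` is the largest round count of the experiments it names). -/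
theorem N0_gt_53550_of_grad_ge_184 {t dO grad εs pΩ : ℝ} (ht : 0 < t) (ht3 : t ≤ Real.logb 2 3)
    (hdO : 0 ≤ dO) (hgrad : 184 ≤ grad) (hε : 0 < εs) (hε1 : εs ≤ 1) (hp : 0 < pΩ) (hp1 : pΩ ≤ 1) :
    (53550 : ℝ) < N0 t dO grad εs pΩ := by
  have hN := N0_ge_gradient_bound ht ht3 hdO (show (0:ℝ) ≤ grad by linarith) hε hε1 hp hp1
  have hlog3 := logb_two_three_lt
  have hlog3pos : 0 < Real.logb 2 3 := Real.logb_pos (by norm_num) (by norm_num)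
  have hceil : (184 : ℝ) ≤ (⌈grad⌉ : ℝ) := le_trans hgrad (Int.le_ceil grad)
  have hq : (232 : ℝ) ≤ 2 * (⌈grad⌉ : ℝ) / Real.logb 2 3 := by
    rw [le_div_iff₀ hlog3pos]; nlinarith
  have hsq : (232 : ℝ) ^ 2 ≤ (2 * (⌈grad⌉ : ℝ) / Real.logb 2 3) ^ 2 :=
    pow_le_pow_left₀ (by norm_num) hq 2
  norm_num at hsq ⊢
  linarith


end Literature.Computability.QuantumComplexity.ProofOfQuantumnessEATRate
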